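import Summits.QuantumFields.GaugeBoot.Rows.AggBindKit
import Summits.QuantumFields.GaugeBoot.Rows.SymLoop
import HarnessLib

/-!
# Gauge-boot: binding kit for AGGREGATED equality rows in `D = 4` with sparse lean2 terms (`…_of_feasible_agg` certificates)

Cell `pub-gaugeboot` (HOME `run/shared/lean/pub/pub-gaugeboot/`), seat lean1 (torus bindings; kz-L2-rp-4D row C105 first).

HONEST FRAMING (page 1 of every file of this cell): certified bounds on lattice expectations at STATED coupling,
gauge group, dimension and torus size; NOT a mass gap, NOT a continuum limit, NOT a string tension, NOT large `N`.
The venture is explicitly NOT Yang–Mills-summit-bearing (barriers `FixedCouplingUltralocality`,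
`PerturbativeInvisibility`).

lean3's 4D kz certificates in aggregated form (`Certificates/KZL2rpD4b<tag>{Up,Lo}`, `var_le_of_feasible_agg`) consume ONE hypothesis
`Σ_v aggRow v · y v = aggRhs` with `aggRow v = RN[v] / RD` over ALL `n` columns (`RN : List ℤ`); lean2 proves that its INTEGER-CODED
aggregated row (`m` terms `(label code, z)`, coefficient `z / M`, `BindZ.decWZ 4`; typically `m < n`) vanishes on the torus state.
As in `AggBindKit` (v3) everything the kernel checks is a LINEAR walk over function-coded data supplied by the seat:
`rnWalk` (lean3's numerator list is the tabulated `rn`), `tsWalk4` (term `j` carries the code of column `col j`, which is `< n`, and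
`z_j · RD = rn (col j) · M`), `colOK` (every column with `rn ≠ 0` is hit: `pos v < m`, `col (pos v) = v`; and `pos (col j) = j`).
`sum_eq_of_walks4` turns lean2's vanishing row sum into `Σ_{v<n} (RN[v]/RD) · f (lab v) = 0` for any valuation `f` of words whose
labels decode through lean2's `BindN.wdg 4`.  [folklore]
-/

noncomputable section

open Literature.MathematicalPhysics.QuantumFieldTheory
open Finset

namespace Summit.QuantumFields.GaugeBoot

namespace AggBind4

/-- Walk: lean3's numerator list from column `v` is `[rn v, rn (v+1), …]`. -/
def rnWalk (rn : ℕ → ℤ) : ℕ → List ℤ → Bool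
  | _, [] => true
  | v, z :: l => decide (z = rn v) && rnWalk rn (v + 1) l

/-- Walk over lean2's coded terms from position `j`: the code is that of column `col j < n` and `z · RD = rn (col j) · M`. -/
def tsWalk4 (n : ℕ) (code : ℕ → ℕ) (rn : ℕ → ℤ) (col : ℕ → ℕ) (M RD : ℕ) : ℕ → List (ℕ × ℤ) → Bool
  | _, [] => true
  | j, t :: l => decide (col j < n) && decide (t.1 = code (col j)) && decide (t.2 * (RD : ℤ) = rn (col j) * (M : ℤ)) &&
      tsWalk4 n code rn col M RD (j + 1) l

/-- Column check: every column with a non-zero numerator is hit by a term (`pos`), and `pos ∘ col = id` on the terms. -/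
def colOK (n m : ℕ) (rn : ℕ → ℤ) (col pos : ℕ → ℕ) : Bool :=
  ((List.range n).all fun v => decide (rn v = 0) || (decide (pos v < m) && decide (col (pos v) = v))) &&
  ((List.range m).all fun j => decide (pos (col j) = j))

/-- `rnWalk` identifies the list with the tabulated function. -/
theorem getD_of_rnWalk (rn : ℕ → ℤ) : ∀ (v : ℕ) (l : List ℤ), rnWalk rn v l = true → ∀ i < l.length, l.getD i 0 = rn (v + i)
  | _, [], _ => by simp
  | v, z :: l, h => by
    simp only [rnWalk, Bool.and_eq_true, decide_eq_true_eq] at h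
    intro i hi
    cases i with
    | zero => simpa using h.1
    | succ i =>
      have := getD_of_rnWalk rn (v + 1) l h.2 i (by simpa using hi)
      simpa [Nat.add_assoc, Nat.add_comm 1 i] using this

/-- The value of lean2's decoded row (`c1` components vanish), `D = 4`. -/
theorem sum_decWZ4 (f : Word 4 → ℝ) (cβ : ℝ) (M : ℕ) : ∀ ts : List (ℕ × ℤ),
    ((BindZ.decWZ 4 ts M).map fun t => (((t.2.1 : ℚ) : ℝ) + ((t.2.2 : ℚ) : ℝ) * cβ) * f t.1).sum =
      (ts.map fun t => ((t.2 : ℝ) / M) * f (BindN.wdg 4 t.1)).sum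
  | [] => by simp [BindZ.decWZ]
  | t :: ts => by
    have ih := sum_decWZ4 f cβ M ts
    simp only [BindZ.decWZ, List.map_cons, List.sum_cons, List.map_map, Function.comp_def] at ih ⊢
    rw [ih]; push_cast; ring

/-- `tsWalk4`: the valued terms, read through `col` (`M, RD > 0`). -/
theorem map_eq_of_tsWalk4 {n : ℕ} (code : ℕ → ℕ) (rn : ℕ → ℤ) (col : ℕ → ℕ) {M RD : ℕ} (hM : 0 < M) (hRD : 0 < RD) (g : ℕ → ℝ → ℝ) :
    ∀ (j : ℕ) (l : List (ℕ × ℤ)), tsWalk4 n code rn col M RD j l = true →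
      (l.map fun t => g t.1 ((t.2 : ℝ) / M)) = (List.range' j l.length).map fun i => g (code (col i)) ((rn (col i) : ℝ) / RD)
  | _, [], _ => by simp
  | j, t :: l, h => by
    simp only [tsWalk4, Bool.and_eq_true, decide_eq_true_eq] at h
    obtain ⟨⟨⟨_, h1⟩, h2⟩, h3⟩ := h
    have hRD' : (RD : ℝ) ≠ 0 := by exact_mod_cast hRD.ne'
    have hM' : (M : ℝ) ≠ 0 := by exact_mod_cast hM.ne'
    have hq : ((t.2 : ℝ) / M) = (rn (col j) : ℝ) / RD := by
      rw [div_eq_div_iff hM' hRD']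
      exact_mod_cast h2
    rw [List.length_cons, List.range'_succ, List.map_cons, List.map_cons,
      map_eq_of_tsWalk4 code rn col hM hRD g (j + 1) l h3, h1, hq]

/-- Terms' columns are `< n`. -/
theorem col_lt_of_tsWalk4 {n : ℕ} (code : ℕ → ℕ) (rn : ℕ → ℤ) (col : ℕ → ℕ) (M RD : ℕ) :
    ∀ (j : ℕ) (l : List (ℕ × ℤ)), tsWalk4 n code rn col M RD j l = true → ∀ i < l.length, col (j + i) < n
  | _, [], _ => by simp
  | j, t :: l, h => by
    simp only [tsWalk4, Bool.and_eq_true, decide_eq_true_eq] at h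
    intro i hi
    cases i with
    | zero => simpa using h.1.1.1
    | succ i =>
      have := col_lt_of_tsWalk4 code rn col M RD (j + 1) l h.2 i (by simpa using hi)
      simpa [Nat.add_assoc, Nat.add_comm 1 i] using this

/-- **From the three linear walks to lean3's aggregated equality (`D = 4`).**  `RN` = lean3's numerators (all `n` columns),
`RD > 0` its denominator, `ts` = lean2's `m` coded terms with denominator `M > 0`; labels decode through `BindN.wdg 4`; lean2's
decoded row vanishes at the valuation `f`.  Then `Σ_{v<n} (RN[v]/RD) · f (lab v) = 0`. -/
theorem sum_eq_of_walks4 {n : ℕ} {code : ℕ → ℕ} {lab : ℕ → Word 4} (hlab : ∀ v < n, lab v = BindN.wdg 4 (code v))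
    (f : Word 4 → ℝ) (cβ : ℝ) {RN : List ℤ} {RD M : ℕ} (hRD : 0 < RD) (hM : 0 < M) {ts : List (ℕ × ℤ)}
    {rn : ℕ → ℤ} {col pos : ℕ → ℕ}
    (hlen : RN.length = n) (hrn : rnWalk rn 0 RN = true) (hts : tsWalk4 n code rn col M RD 0 ts = true)
    (hcol : colOK n ts.length rn col pos = true)
    (hE : ((BindZ.decWZ 4 ts M).map fun t => (((t.2.1 : ℚ) : ℝ) + ((t.2.2 : ℚ) : ℝ) * cβ) * f t.1).sum = 0) :
    ∑ v : Fin n, ((RN.getD v.val 0 : ℤ) : ℝ) / (RD : ℝ) * f (lab v.val) = 0 := by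
  classical
  set m := ts.length with hm
  have hRD' : (RD : ℝ) ≠ 0 := by exact_mod_cast hRD.ne'
  -- lean3's side through `rn`
  have hget : ∀ v : Fin n, RN.getD v.val 0 = rn v.val := fun v => by
    have := getD_of_rnWalk rn 0 RN hrn v.val (by rw [hlen]; exact v.isLt); simpa using this
  simp_rw [hget]
  -- columns: `col` is an injection `Fin m → Fin n` covering the support of `rn`
  simp only [colOK, Bool.and_eq_true, List.all_eq_true, List.mem_range, Bool.or_eq_true, decide_eq_true_eq] at hcol
  obtain ⟨hcover, hinj⟩ := hcol
  have hclt : ∀ j < m, col j < n := fun j hj => by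
    have := col_lt_of_tsWalk4 code rn col M RD 0 ts hts j hj; simpa using this
  let colF : Fin m → Fin n := fun j => ⟨col j.val, hclt j.val j.isLt⟩
  have hcinj : Function.Injective colF := by
    intro a b h
    have h' : col a.val = col b.val := by simpa [colF] using congrArg Fin.val h
    have := hinj a.val a.isLt; have := hinj b.val b.isLt
    apply Fin.ext
    calc a.val = pos (col a.val) := (hinj a.val a.isLt).symm
      _ = pos (col b.val) := by rw [h']
      _ = b.val := hinj b.val b.isLt
  have hsum : ∑ v : Fin n, ((rn v.val : ℤ) : ℝ) / RD * f (lab v.val) = ∑ j : Fin m, ((rn (col j.val) : ℤ) : ℝ) / RD * f (lab (col j.val)) := by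
    have himg : ∑ j : Fin m, ((rn (col j.val) : ℤ) : ℝ) / RD * f (lab (col j.val)) =
        ∑ v ∈ (univ : Finset (Fin m)).image colF, ((rn v.val : ℤ) : ℝ) / RD * f (lab v.val) := by
      rw [Finset.sum_image fun a _ b _ h => hcinj h]
    rw [himg]
    symm
    refine Finset.sum_subset (Finset.subset_univ _) fun v _ hv => ?_
    have hz : rn v.val = 0 := by
      rcases hcover v.val v.isLt with h | ⟨hp, hc⟩
      · exact h
      · exfalso; exact hv (Finset.mem_image.mpr ⟨⟨pos v.val, hp⟩, Finset.mem_univ _, Fin.ext hc⟩)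
    simp [hz]
  rw [hsum]
  -- lean2's side
  rw [sum_decWZ4] at hE
  have hts' := map_eq_of_tsWalk4 code rn col hM hRD (fun c q => q * f (BindN.wdg 4 c)) 0 ts hts
  rw [hts', ← hm, ← List.range_eq_range', SymB4.sum_map_range] at hE
  rw [Fin.sum_univ_eq_sum_range (fun j => ((rn (col j) : ℤ) : ℝ) / RD * f (lab (col j))) m, ← hE]
  refine Finset.sum_congr rfl fun j hj => ?_
  rw [hlab (col j) (hclt j (Finset.mem_range.mp hj))]

end AggBind4

end Summit.QuantumFields.GaugeBoot

end
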